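import Mathlib
import Summits.Ventures.PercRepro2.MixChordRoot

/-!
# Signed pieces of the exploration-martingale decomposition of (MIX-CHORD) (blind cell PercRepro2,
night-1 g19; proofs/NIGHT1-G19.md §3)

Along a root edge `e = {a₁, y}` the deficit of the mixed chord decomposes (NIGHT1-G19.md §3, an
exact identity) into the Q-between term `T_Q = Z·π(1 − π)·Δσ_b·ΔF`, the PD-between term
`T_PD = −D·π_D(1 − π_D)·Δ1_{bU}·Δ1_{oU}` and the γ-correction `T_γ`, which carries the conditional
covariances `C = Cov_Q(σ_b, σ₃)` of the two children.  This file lands the pieces that are theorems: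

* **`covQ_sb_s3_nonneg`**: `0 ≤ Z · E_Q[σ_b σ₃] + gap · E_Q[σ₃]`, i.e. `Cov_Q(σ_b, σ₃) ≥ 0` — `b` and
  `a₃` are on the same side of `Q` more often than independence predicts: four BHK inequalities
  (same cluster `{a₃ ∈ C₂, b ∈ C₂}` / `{a₃ ∈ C₁, b ∈ C₁}`, cross cluster `{a₃ ∈ C₂, b ∈ C₁}` /
  `{a₃ ∈ C₁, b ∈ C₂}`), the root-swapped pair from `RootEdge.T_mul_QbH_le` / `Q_mul_TbL_le`;
* `Δσ_b ≥ 0` is g18's `RootEdge.fac1_nonpos` (stated for an edge `{a₃, a₁}` with `a₃` an arbitrary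
  vertex: `Z⁰ gap¹ ≤ Z¹ gap⁰`, i.e. `E_{Q¹}[σ_b] ≥ E_{Q⁰}[σ_b]`), recorded here as
  **`condMean_sb_update_ge`** for every edge `{y, a₁}`.

Own code; standard axioms.
-/

namespace Summit.Ventures.PercRepro2

open UnionCluster CovForm

namespace Mix

section Pieces

variable {V : Type*} {E : Type*} [Fintype E] [DecidableEq E] [Fintype V] [DecidableEq V]
  {R : Type*} [Field R] [LinearOrder R] [IsStrictOrderedRing R]

variable (p : E → R) (ends : E → Sym2 V) (a₁ a₂ a₃ b : V)

/-- Same-cluster BHK for `{a₃ ∈ C₁}`, `{b ∈ C₁}`: `P(T′) P(Q, bL) ≤ P(Q) P(T′, bL)`. -/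
lemma T'_mul_QbL_le (hp : IsProbVec p) :
    prob p (TEvent ends a₂ a₁ a₃) * prob p (avoidAll ends a₂ {a₁} ∩ connEvent ends a₁ b) ≤
      prob p (avoidAll ends a₂ {a₁}) * prob p (TEvent ends a₂ a₁ a₃ ∩ connEvent ends a₁ b) := by
  have h := RootEdge.T_mul_QbH_le p ends b hp (a₁ := a₂) (a₂ := a₁) (a₃ := a₃)
  rw [avoidAll_root_swap] at h
  exact h

/-- Cross-cluster BHK for `{a₃ ∈ C₁}`, `{b ∈ C₂}`: `P(Q) P(T′, bH) ≤ P(T′) P(Q, bH)`. -/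
lemma Q_mul_T'bH_le (hp : IsProbVec p) :
    prob p (avoidAll ends a₂ {a₁}) * prob p (TEvent ends a₂ a₁ a₃ ∩ connEvent ends a₂ b) ≤
      prob p (TEvent ends a₂ a₁ a₃) * prob p (avoidAll ends a₂ {a₁} ∩ connEvent ends a₂ b) := by
  have h := RootEdge.Q_mul_TbL_le p ends b hp (a₁ := a₂) (a₂ := a₁) (a₃ := a₃)
  rw [avoidAll_root_swap] at h
  exact h

/-- **`Cov_Q(σ_b, σ₃) ≥ 0`**, cleared: `0 ≤ Z · E_Q[σ_b σ₃] + gap · E_Q[σ₃]`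
(`E_Q[σ_b] = −gap`). -/
theorem covQ_sb_s3_nonneg (hp : IsProbVec p) :
    0 ≤ prob p (avoidAll ends a₂ {a₁}) * EQb3 p ends a₁ a₂ a₃ b +
      gap p ends a₁ a₂ b * EQ3 p ends a₁ a₂ a₃ := by
  have h1 := RootEdge.T_mul_QbH_le p ends b hp (a₁ := a₁) (a₂ := a₂) (a₃ := a₃)
  have h2 := RootEdge.Q_mul_TbL_le p ends b hp (a₁ := a₁) (a₂ := a₂) (a₃ := a₃)
  have h3 := T'_mul_QbL_le p ends a₁ a₂ a₃ b hp
  have h4 := Q_mul_T'bH_le p ends a₁ a₂ a₃ b hp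
  rw [gap_eq_Q]
  unfold EQb3 EQ3
  nlinarith [h1, h2, h3, h4]

end Pieces

section CondMean

variable {V : Type*} {E : Type*} [Fintype E] [DecidableEq E] [Fintype V] [DecidableEq V]
  {R : Type*} [Field R] [LinearOrder R] [IsStrictOrderedRing R]

variable (p : E → R) (ends : E → Sym2 V) {a₁ a₂ : V} (b : V) {f : E} {y : V}

/-- **Opening an edge at `a₁` raises the conditional mean of `σ_b`** (cleared): for `f = {y, a₁}`
with `y` arbitrary, `Z⁰ · gap¹ ≤ Z¹ · gap⁰` — g18's `RootEdge.fac1_nonpos` read for the far end `y`. -/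
theorem condMean_sb_update_ge (hp : IsProbVec p) (hf : ends f = s(y, a₁)) :
    prob (Function.update p f 0) (avoidAll ends a₂ {a₁}) * gap (Function.update p f 1) ends a₁ a₂ b ≤
      prob (Function.update p f 1) (avoidAll ends a₂ {a₁}) * gap (Function.update p f 0) ends a₁ a₂ b := by
  have h := RootEdge.fac1_nonpos p ends b hp (a₂ := a₂) (a₃ := y) hf
  unfold RootEdge.fac1 at h
  linarith [h]

end CondMean

end Mix

end Summit.Ventures.PercRepro2
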